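import Literature.NumberTheory.Automorphic.JacquetModule
import Literature.NumberTheory.Automorphic.UnitaryGroupAutomorphicRep
import Literature.NumberTheory.Automorphic.AddCharConductorExponent          -- ★ `exists_coe_valued_eq_exp_neg_one` (uniformizers of `L_w`)
import Literature.NumberTheory.Automorphic.LocalRingUnitsCharacterLocallyConstant  -- ★ boxes of `E_v = Π L_w` (`Fintype (PlacesOver L v)`), as in ★ `F0P3cStCharTSMuTrivial`
import HarnessLib

/-!
# «LEVEL-PICK★» — picking principal-congruence levels under a continuous product map (ROAD-D, CHANGE 1)

Count-neutral helper kit for the stable-character transfer statement of the `H413` crux chain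
(`--supports stmt-HodgeConjecture-24833`), dealt by the LH6 road-(D) owner: THEOREMS ONLY, no new objects.

* §1 **(LP1)** generic topology: if `ψ : A × B → G` is continuous at `(1, 1)` with `ψ (1, 1) = 1` and `KA : ℕ → Set A`,
  `KB : ℕ → Set B` are eventually inside every neighbourhood of `1`, then for every `V ∈ 𝓝 1` some `ψ '' (KA n₁ ×ˢ KB n₂) ⊆ V`
  (`exists_image_prod_subset_of_continuousAt`); one-index form for antitone families
  (`exists_image_prod_subset_of_continuousAt_of_antitone`).
* §2 **(LP2)** the Iwahori instance: for Iwahori data `𝓘A, 𝓘B, 𝓘` (★ `ParabolicTriple.IwahoriDatum`, whose `K n` are open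
  and form a neighbourhood basis of `1`) and a continuous homomorphism `ψ : A × B →* G`, every level `𝓘.K n ∩ W` (`W` an open
  neighbourhood of `1`) contains some `ψ (𝓘A.K n₁ × 𝓘B.K n₂)` (`exists_image_iwahoriK_prod_subset`, + antitone one-index form).
* §3 **(LP3) «BOX-OPEN»**: in `E_v = Π_{w ∣ v} L_w` (★ `UnitaryGroup.LocalRing`) the principal congruence box
  `{x | ∀ w, |x_w − 1|_w < q_w^{−(n+1)}}` of ★ `exists_level_forall_finHeckeValue_eq_one` is open and contains `1`, hence is a
  neighbourhood of `1` (`isOpen_levelBox`, `one_mem_levelBox`, `levelBox_mem_nhds_one`); the neighbourhood form of `μ_v = 1` is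
  ★ `exists_nhds_one_forall_finHeckeValue_eq_one` (cited, not restated).

## References
* [Casselman1995] W. Casselman, *Introduction to the theory of admissible representations of p-adic reductive groups* (1995),
  Prop. 1.4.4 (compact open subgroups with Iwahori factorisation form a basis of neighbourhoods of `1`).
* [BernsteinZelevinsky1976] I. N. Bernstein, A. V. Zelevinsky, *Representations of the group GL(n, F) where F is a
  non-archimedean local field* (1976), §1.7 (l-groups: a basis of compact open subgroups at `1`).
* [TateThesis1967] J. Tate, *Fourier analysis in number fields and Hecke's zeta-functions* (Cassels–Fröhlich 1967), §2.3
  (the groups `1 + 𝔭ⁿ` are open neighbourhoods of `1`).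
* [Rogawski1990] J. D. Rogawski, *Automorphic Representations of Unitary Groups in Three Variables* (1990), Prop. 8.1.3
  proof p. 116 («for `t` sufficiently close to `1`»).
-/

set_option autoImplicit false
-- the mandated namespace has the single-problem summit's repeated segment (`HodgeConjecture.HodgeConjecture`)
set_option linter.dupNamespace false

open Filter Topology NumberField IsDedekindDomain
open Literature.NumberTheory.Automorphic Literature.NumberTheory.Automorphic.UnitaryGroup

namespace Summit.HodgeConjecture.HodgeConjecture.Cruxes.H413.F0P3cStCharTSLevelPick

/-! ## §1 (LP1) The generic level pick -/

/-- **(LP1) LEVEL PICK, generic form.** If `ψ : A × B → G` is continuous at `(1, 1)` with `ψ (1, 1) = 1` and the families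
`KA`, `KB` are eventually inside every neighbourhood of `1`, then every neighbourhood `V` of `1 : G` contains some
`ψ '' (KA n₁ ×ˢ KB n₂)`. [cite: Casselman1995, Prop. 1.4.4] [cite: BernsteinZelevinsky1976, §1.7] -/
theorem exists_image_prod_subset_of_continuousAt {A B G : Type*} [TopologicalSpace A] [TopologicalSpace B]
    [TopologicalSpace G] [One A] [One B] [One G] {ψ : A × B → G} (hψ : ContinuousAt ψ (1, 1)) (hψ1 : ψ (1, 1) = 1)
    {KA : ℕ → Set A} {KB : ℕ → Set B} (hA : ∀ U ∈ 𝓝 (1 : A), ∃ n, KA n ⊆ U) (hB : ∀ U ∈ 𝓝 (1 : B), ∃ n, KB n ⊆ U)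
    {V : Set G} (hV : V ∈ 𝓝 (1 : G)) : ∃ n₁ n₂, ψ '' (KA n₁ ×ˢ KB n₂) ⊆ V := by
  have h : ψ ⁻¹' V ∈ 𝓝 ((1 : A), (1 : B)) := hψ.preimage_mem_nhds (by rwa [hψ1])
  obtain ⟨U₁, hU₁, U₂, hU₂, hsub⟩ := mem_nhds_prod_iff.1 h
  obtain ⟨n₁, hn₁⟩ := hA U₁ hU₁
  obtain ⟨n₂, hn₂⟩ := hB U₂ hU₂
  exact ⟨n₁, n₂, Set.image_subset_iff.2 ((Set.prod_mono hn₁ hn₂).trans hsub)⟩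

/-- **(LP1) one-index form** for antitone families: some `ψ '' (KA n ×ˢ KB n) ⊆ V`.
[cite: Casselman1995, Prop. 1.4.4] [cite: BernsteinZelevinsky1976, §1.7] -/
theorem exists_image_prod_subset_of_continuousAt_of_antitone {A B G : Type*} [TopologicalSpace A] [TopologicalSpace B]
    [TopologicalSpace G] [One A] [One B] [One G] {ψ : A × B → G} (hψ : ContinuousAt ψ (1, 1)) (hψ1 : ψ (1, 1) = 1)
    {KA : ℕ → Set A} {KB : ℕ → Set B} (hKA : Antitone KA) (hKB : Antitone KB)
    (hA : ∀ U ∈ 𝓝 (1 : A), ∃ n, KA n ⊆ U) (hB : ∀ U ∈ 𝓝 (1 : B), ∃ n, KB n ⊆ U)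
    {V : Set G} (hV : V ∈ 𝓝 (1 : G)) : ∃ n, ψ '' (KA n ×ˢ KB n) ⊆ V := by
  obtain ⟨n₁, n₂, h⟩ := exists_image_prod_subset_of_continuousAt hψ hψ1 hA hB hV
  exact ⟨max n₁ n₂, (Set.image_mono (Set.prod_mono (hKA (le_max_left _ _)) (hKB (le_max_right _ _)))).trans h⟩

/-- **(LP1) with a prescribed index floor**: the indices may be taken `≥ n₀` (enlarge `U` to `U ∩ KA n₀`-free form: apply (LP1) to
the shifted families `k ↦ KA (n₀ + k)`), for antitone families. [cite: Casselman1995, Prop. 1.4.4] -/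
theorem exists_image_prod_subset_of_continuousAt_of_antitone_ge {A B G : Type*} [TopologicalSpace A] [TopologicalSpace B]
    [TopologicalSpace G] [One A] [One B] [One G] {ψ : A × B → G} (hψ : ContinuousAt ψ (1, 1)) (hψ1 : ψ (1, 1) = 1)
    {KA : ℕ → Set A} {KB : ℕ → Set B} (hKA : Antitone KA) (hKB : Antitone KB)
    (hA : ∀ U ∈ 𝓝 (1 : A), ∃ n, KA n ⊆ U) (hB : ∀ U ∈ 𝓝 (1 : B), ∃ n, KB n ⊆ U)
    {V : Set G} (hV : V ∈ 𝓝 (1 : G)) (n₀ : ℕ) : ∃ n, n₀ ≤ n ∧ ψ '' (KA n ×ˢ KB n) ⊆ V := by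
  obtain ⟨n, h⟩ := exists_image_prod_subset_of_continuousAt_of_antitone hψ hψ1 hKA hKB hA hB hV
  exact ⟨max n₀ n, le_max_left _ _,
    (Set.image_mono (Set.prod_mono (hKA (le_max_right _ _)) (hKB (le_max_right _ _)))).trans h⟩

/-! ## §2 (LP2) The Iwahori instance -/

/-- **(LP2) LEVEL PICK for Iwahori data.** For Iwahori data `𝓘A`, `𝓘B`, `𝓘` (compact open `K n` forming neighbourhood bases of
`1`) and a continuous homomorphism `ψ : A × B →* G`, every `𝓘.K n ∩ W` (`W` an open neighbourhood of `1`) contains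
`ψ (𝓘A.K n₁ × 𝓘B.K n₂)` for some `n₁, n₂`. [cite: Casselman1995, Prop. 1.4.4] [cite: BernsteinZelevinsky1976, §1.7] -/
theorem exists_image_iwahoriK_prod_subset {A B G : Type*} [Group A] [TopologicalSpace A] [Group B] [TopologicalSpace B]
    [Group G] [TopologicalSpace G] {tA : ParabolicTriple A} (𝓘A : tA.IwahoriDatum) {tB : ParabolicTriple B}
    (𝓘B : tB.IwahoriDatum) {t : ParabolicTriple G} (𝓘 : t.IwahoriDatum) (ψ : A × B →* G) (hψ : Continuous ψ) (n : ℕ)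
    {W : Set G} (hW : IsOpen W) (h1 : (1 : G) ∈ W) :
    ∃ n₁ n₂, ψ '' ((𝓘A.K n₁ : Set A) ×ˢ (𝓘B.K n₂ : Set B)) ⊆ (𝓘.K n : Set G) ∩ W :=
  exists_image_prod_subset_of_continuousAt (KA := fun k => (𝓘A.K k : Set A)) (KB := fun k => (𝓘B.K k : Set B))
    hψ.continuousAt (map_one ψ) 𝓘A.hasBasis_K 𝓘B.hasBasis_K
    (Filter.inter_mem ((𝓘.isOpen_K n).mem_nhds (one_mem _)) (hW.mem_nhds h1))

/-- **(LP2) one-index form** when the level families are antitone (`K (k+1) ≤ K k`), with a prescribed floor `n₀ ≤ m`.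
[cite: Casselman1995, Prop. 1.4.4] [cite: BernsteinZelevinsky1976, §1.7] -/
theorem exists_image_iwahoriK_prod_subset_of_antitone {A B G : Type*} [Group A] [TopologicalSpace A] [Group B]
    [TopologicalSpace B] [Group G] [TopologicalSpace G] {tA : ParabolicTriple A} (𝓘A : tA.IwahoriDatum)
    {tB : ParabolicTriple B} (𝓘B : tB.IwahoriDatum) {t : ParabolicTriple G} (𝓘 : t.IwahoriDatum)
    (hKA : Antitone fun k => (𝓘A.K k : Set A)) (hKB : Antitone fun k => (𝓘B.K k : Set B))
    (ψ : A × B →* G) (hψ : Continuous ψ) (n : ℕ) {W : Set G} (hW : IsOpen W) (h1 : (1 : G) ∈ W) (n₀ : ℕ) :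
    ∃ m, n₀ ≤ m ∧ ψ '' ((𝓘A.K m : Set A) ×ˢ (𝓘B.K m : Set B)) ⊆ (𝓘.K n : Set G) ∩ W :=
  exists_image_prod_subset_of_continuousAt_of_antitone_ge (KA := fun k => (𝓘A.K k : Set A))
    (KB := fun k => (𝓘B.K k : Set B)) hψ.continuousAt (map_one ψ) hKA hKB 𝓘A.hasBasis_K 𝓘B.hasBasis_K
    (Filter.inter_mem ((𝓘.isOpen_K n).mem_nhds (one_mem _)) (hW.mem_nhds h1)) n₀

/-- **(LP2′) values in the level**: under (LP2), `ψ (a, b) ∈ 𝓘.K n` and `ψ (a, b) ∈ W` for all `a ∈ 𝓘A.K n₁`, `b ∈ 𝓘B.K n₂`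
(the pointwise spelling consumed downstream). [cite: Casselman1995, Prop. 1.4.4] -/
theorem exists_forall_map_mem_iwahoriK {A B G : Type*} [Group A] [TopologicalSpace A] [Group B] [TopologicalSpace B]
    [Group G] [TopologicalSpace G] {tA : ParabolicTriple A} (𝓘A : tA.IwahoriDatum) {tB : ParabolicTriple B}
    (𝓘B : tB.IwahoriDatum) {t : ParabolicTriple G} (𝓘 : t.IwahoriDatum) (ψ : A × B →* G) (hψ : Continuous ψ) (n : ℕ)
    {W : Set G} (hW : IsOpen W) (h1 : (1 : G) ∈ W) :
    ∃ n₁ n₂, ∀ a ∈ 𝓘A.K n₁, ∀ b ∈ 𝓘B.K n₂, ψ (a, b) ∈ 𝓘.K n ∧ ψ (a, b) ∈ W := by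
  obtain ⟨n₁, n₂, h⟩ := exists_image_iwahoriK_prod_subset 𝓘A 𝓘B 𝓘 ψ hψ n hW h1
  exact ⟨n₁, n₂, fun a ha b hb => h (Set.mem_image_of_mem ψ (Set.mk_mem_prod ha hb))⟩

/-! ## §3 (LP3) «BOX-OPEN»: the principal congruence box of `E_v` is a neighbourhood of `1` -/

variable (L : Type) [Field L] [NumberField L] (v : HeightOneSpectrum (𝓞 ↥(maximalRealSubfield L)))

/-- One coordinate: the strict ball `{y : L_w | |y − 1|_w < q_w^{−(n+1)}}` is open (it is the translate of the open ball
★ `Valued.isOpen_ball` of radius `|π_w^{n+1}|_w`, `π_w` a uniformizer ★ `exists_coe_valued_eq_exp_neg_one`).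
[cite: TateThesis1967, §2.3] -/
theorem isOpen_setOf_valued_sub_one_lt (w : PlacesOver L v) (n : ℕ) :
    IsOpen {y : w.1.adicCompletion L | Valued.v (y - 1) < WithZero.exp (-((n + 1 : ℕ) : ℤ))} := by
  obtain ⟨π, -, hπ⟩ := exists_coe_valued_eq_exp_neg_one (K := L) w.1
  have ha : Valued.v ((π : w.1.adicCompletion L) ^ (n + 1)) = WithZero.exp (-((n + 1 : ℕ) : ℤ)) := by
    rw [map_pow, hπ, ← WithZero.exp_nsmul, smul_neg, nsmul_one]
  have hset : {y : w.1.adicCompletion L | Valued.v (y - 1) < WithZero.exp (-((n + 1 : ℕ) : ℤ))}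
      = (fun y : w.1.adicCompletion L => y - 1) ⁻¹'
        {z | Valued.v.restrict z < Valued.v.restrict ((π : w.1.adicCompletion L) ^ (n + 1))} := by
    ext y
    simp only [Set.mem_preimage, Set.mem_setOf_eq, Valuation.restrict_lt_iff, ha]
  rw [hset]
  exact IsOpen.preimage (continuous_id.sub continuous_const) (by apply Valued.isOpen_ball)

/-- **(LP3) «BOX-OPEN»**: the principal congruence box `{x : E_v | ∀ w ∣ v, |x_w − 1|_w < q_w^{−(n+1)}}` of
★ `exists_level_forall_finHeckeValue_eq_one` is open in `E_v = Π_{w ∣ v} L_w`. [cite: TateThesis1967, §2.3]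
[cite: Rogawski1990, Prop. 8.1.3 proof p. 116] -/
theorem isOpen_levelBox (n : ℕ) :
    IsOpen {x : UnitaryGroup.LocalRing L v |
      ∀ w : PlacesOver L v, Valued.v (x w - 1) < WithZero.exp (-((n + 1 : ℕ) : ℤ))} := by
  have h : {x : UnitaryGroup.LocalRing L v | ∀ w : PlacesOver L v, Valued.v (x w - 1) < WithZero.exp (-((n + 1 : ℕ) : ℤ))}
      = ⋂ w : PlacesOver L v, (fun x : UnitaryGroup.LocalRing L v => x w) ⁻¹'
          {y : w.1.adicCompletion L | Valued.v (y - 1) < WithZero.exp (-((n + 1 : ℕ) : ℤ))} := by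
    ext x
    simp only [Set.mem_setOf_eq, Set.mem_iInter, Set.mem_preimage]
  rw [h]
  exact isOpen_iInter_of_finite fun w =>
    (continuous_apply w).isOpen_preimage _ (isOpen_setOf_valued_sub_one_lt L v w n)

/-- **(LP3) the box contains `1`** (`|1 − 1|_w = 0 < q_w^{−(n+1)}`). [cite: TateThesis1967, §2.3] -/
theorem one_mem_levelBox (n : ℕ) :
    (1 : UnitaryGroup.LocalRing L v) ∈ {x : UnitaryGroup.LocalRing L v |
      ∀ w : PlacesOver L v, Valued.v (x w - 1) < WithZero.exp (-((n + 1 : ℕ) : ℤ))} := by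
  intro w
  rw [Pi.one_apply, sub_self, map_zero]
  exact zero_lt_iff.2 WithZero.exp_ne_zero

/-- **(LP3) the box is a neighbourhood of `1`** in `E_v`. [cite: TateThesis1967, §2.3] [cite: Rogawski1990, Prop. 8.1.3 proof p. 116] -/
theorem levelBox_mem_nhds_one (n : ℕ) :
    {x : UnitaryGroup.LocalRing L v | ∀ w : PlacesOver L v, Valued.v (x w - 1) < WithZero.exp (-((n + 1 : ℕ) : ℤ))}
      ∈ 𝓝 (1 : UnitaryGroup.LocalRing L v) :=
  (isOpen_levelBox L v n).mem_nhds (one_mem_levelBox L v n)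

/-- **(LP3′) boxes eventually inside**: a neighbourhood of `1` given as a level box can be fed to (LP1) — for every `n` the
family `k ↦ box (n + k)` is inside `box n` (antitone in the level). [cite: TateThesis1967, §2.3] -/
theorem levelBox_antitone {m n : ℕ} (hmn : m ≤ n) :
    {x : UnitaryGroup.LocalRing L v | ∀ w : PlacesOver L v, Valued.v (x w - 1) < WithZero.exp (-((n + 1 : ℕ) : ℤ))}
      ⊆ {x : UnitaryGroup.LocalRing L v | ∀ w : PlacesOver L v, Valued.v (x w - 1) < WithZero.exp (-((m + 1 : ℕ) : ℤ))} := by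
  intro x hx w
  refine lt_of_lt_of_le (hx w) (WithZero.exp_le_exp.2 ?_)
  omega

end Summit.HodgeConjecture.HodgeConjecture.Cruxes.H413.F0P3cStCharTSLevelPick
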